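import Summits.Ventures.YMGap.Thresholds.OneLinkPoissonCovariance
import HarnessLib

/-!
# Venture YMGap — the one-link modulus beyond first order, part 42: the Poisson covariance engine with a SPLIT remainder
# (Bakry–Émery only on the non-linear part; the linear part is carried as a covariance to be bounded by a modulus)

HONEST FRAMING: venture file of the cell `pub-ymgap` (QuantumFields programme), strong-coupling LATTICE bookkeeping for `SU(N)`
lattice Yang–Mills; nothing about the continuum or the mass gap in the Clay sense.  No number of record: this generalises
`OneLinkPoissonCovariance.cov_linear_le_of_poisson` (cell note `HOME/p2/ONE-LINK-HIERARCHY.md` §15 (1) «linear bootstrap» and the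
engine every higher level of the hierarchy needs, §15 (3)).

WHAT.  `ν_B(dg) ∝ exp(N Re tr(gB)) dg`, `‖B‖_op < 1/2`, `u = Re tr(·Δ)`, `λ₁ = N − 1/N`.  Suppose smooth `ψ`, `c`, a matrix `M` and a
constant `κ` satisfy ON `SU(N)` the decomposition
  `Δ_LB ψ + N Γ(Re tr(·B), u) + N Γ(Re tr(·B), ψ) = κ + Re tr(·M) + N·c`                          (hypothesis `hdec`)
(the tree's level two is `ψ = ψ₂`, `M = 0`, `c = Γ(Re tr(·B), ψ₂)`; the bootstrap is `ψ = ψ₂`, `Re tr(·M)` = the linear part of `N c₃`,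
`c` = the rest; level three is `ψ = ψ₂ + ψ₃`, `c = c₄`).  Then (`cov_linear_le_of_poisson_split`) for every bounded measurable
`L`-Lipschitz `φ`:
  `|Cov_ν(φ, N u)| ≤ (N²/(N²−1))·L·[‖∇(u+ψ)‖_{L²(ν)} + ‖∇c‖_{L²(ν)}/(1/2 − ‖B‖_op)] + (N²/(N²−1))·|Cov_ν(φ, Re tr(·M))|`.
PROOF: as in part 2 (`u = (−L_S(u+ψ) + κ + Re tr(·M) + N c)/λ₁` pointwise; integration by parts in `L²` for the `L_S` term; Poincaré
twice for `c`), with the covariance against the linear statistic `Re tr(·M)` simply carried to the right-hand side — to be bounded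
by the user with a one-link modulus (`|Cov_ν(φ, N Re tr(·M))| ≤ K·L·‖M‖_F`), which is where the nesting / bootstrap happens.

References: cell notes `HOME/p2/ONE-LINK-HIERARCHY.md` §3–§4, §15; Bakry–Gentil–Ledoux, Grundlehren 348, Prop. 4.8.1.
-/

noncomputable section

open scoped Matrix ComplexConjugate BigOperators ContDiff Matrix.Norms.Frobenius
open Matrix Complex Finset MeasureTheory ProbabilityTheory
open Literature.MathematicalPhysics.QuantumFieldTheory
open Literature.MathematicalPhysics.QuantumFieldTheory.SUNBakryEmery

namespace Summit.Ventures.YMGap.OneLinkEigen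

variable {N : ℕ}

/-- **Covariance of a Lipschitz observable with a linear statistic from an approximate Poisson solution with a SPLIT remainder**
(`hdec`): `|Cov_ν(φ, N u)| ≤ C·L·[‖∇(u+ψ)‖₂ + ‖∇c‖₂/(1/2 − ‖B‖_op)] + C·|Cov_ν(φ, Re tr(·M))|`, `C = N²/(N²−1)`. [folklore] -/
theorem cov_linear_le_of_poisson_split (hN : 2 ≤ N) {B : Matrix (Fin N) (Fin N) ℂ} (hB : matrixOpNorm B < 1 / 2)
    (Δ : Matrix (Fin N) (Fin N) ℂ) {ψ : Matrix (Fin N) (Fin N) ℂ → ℝ} (hψ : ContDiff ℝ ∞ ψ)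
    {c : Matrix (Fin N) (Fin N) ℂ → ℝ} (hc : ContDiff ℝ ∞ c) (M : Matrix (Fin N) (Fin N) ℂ) {κ : ℝ}
    (hdec : ∀ g : SUN N, Lap ψ g + (N : ℝ) * Gam (pot 1 B) (pot 1 Δ) g + (N : ℝ) * Gam (pot 1 B) ψ g =
      κ + pot 1 M g + (N : ℝ) * c g)
    (φ : SUN N → ℝ) {L : ℝ} (hφm : Measurable φ) (hφb : ∃ C, ∀ s, |φ s| ≤ C)
    (hL : 0 ≤ L) (hφL : ∀ a b, |φ a - φ b| ≤ L * suFrobDist a b) :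
    |∫ s, φ s * ((N : ℝ) * ((s : Matrix (Fin N) (Fin N) ℂ) * Δ).trace.re)
          ∂(haarProbability (SUN N)).tilted (fun g => (N : ℝ) * ((g : Matrix (Fin N) (Fin N) ℂ) * B).trace.re) -
        (∫ s, φ s ∂(haarProbability (SUN N)).tilted (fun g => (N : ℝ) * ((g : Matrix (Fin N) (Fin N) ℂ) * B).trace.re)) *
          ∫ s, (N : ℝ) * ((s : Matrix (Fin N) (Fin N) ℂ) * Δ).trace.re
            ∂(haarProbability (SUN N)).tilted (fun g => (N : ℝ) * ((g : Matrix (Fin N) (Fin N) ℂ) * B).trace.re)| ≤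
      (N : ℝ) ^ 2 / ((N : ℝ) ^ 2 - 1) * L *
        (Real.sqrt (∫ g, Gam (pot 1 Δ + ψ) (pot 1 Δ + ψ) g
            ∂(haarProbability (SUN N)).tilted (fun g => (N : ℝ) * ((g : Matrix (Fin N) (Fin N) ℂ) * B).trace.re)) +
          Real.sqrt (∫ g, Gam c c g
            ∂(haarProbability (SUN N)).tilted (fun g => (N : ℝ) * ((g : Matrix (Fin N) (Fin N) ℂ) * B).trace.re)) /
            (1 / 2 - matrixOpNorm B))
      + (N : ℝ) ^ 2 / ((N : ℝ) ^ 2 - 1) *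
        |∫ s, φ s * pot 1 M (s : Matrix (Fin N) (Fin N) ℂ)
            ∂(haarProbability (SUN N)).tilted (fun g => (N : ℝ) * ((g : Matrix (Fin N) (Fin N) ℂ) * B).trace.re) -
          (∫ s, φ s ∂(haarProbability (SUN N)).tilted (fun g => (N : ℝ) * ((g : Matrix (Fin N) (Fin N) ℂ) * B).trace.re)) *
            ∫ s, pot 1 M (s : Matrix (Fin N) (Fin N) ℂ)
              ∂(haarProbability (SUN N)).tilted (fun g => (N : ℝ) * ((g : Matrix (Fin N) (Fin N) ℂ) * B).trace.re)| := by
  have hN0 : N ≠ 0 := by omega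
  have hNpos : (0 : ℝ) < N := Nat.cast_pos.2 (Nat.pos_of_ne_zero hN0)
  have hN2 : (2 : ℝ) ≤ N := by exact_mod_cast hN
  set R : ℝ := matrixOpNorm B with hRdef
  have hR0 : 0 ≤ R := matrixOpNorm_nonneg B
  have hRpos : 0 < 1 / 2 - R := by linarith
  set lam : ℝ := (N : ℝ) - 1 / N with hlam
  have hlampos : 0 < lam := by
    have : (1 : ℝ) / N ≤ 1 / 2 := by rw [div_le_div_iff₀ hNpos (by norm_num)]; linarith
    rw [hlam]; linarith
  have hlam_eq : (N : ℝ) / lam = (N : ℝ) ^ 2 / ((N : ℝ) ^ 2 - 1) := by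
    rw [hlam]; field_simp
  -- the ambient objects
  set S : Matrix (Fin N) (Fin N) ℂ → ℝ := pot (N : ℝ) B with hSdef
  set u : Matrix (Fin N) (Fin N) ℂ → ℝ := pot 1 Δ with hudef
  set Ψ : Matrix (Fin N) (Fin N) ℂ → ℝ := pot 1 Δ + ψ with hΨdef
  have hS : ContDiff ℝ ∞ S := contDiff_pot _ B
  have hu : ContDiff ℝ ∞ u := contDiff_pot _ Δ
  have hΨ : ContDiff ℝ ∞ Ψ := (contDiff_pot 1 Δ).add hψ
  set ν : Measure (SUN N) :=
    (haarProbability (SUN N)).tilted (fun g => (N : ℝ) * ((g : Matrix (Fin N) (Fin N) ℂ) * B).trace.re) with hν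
  have hSg : ∀ g : SUN N, (N : ℝ) * ((g : Matrix (Fin N) (Fin N) ℂ) * B).trace.re = S g := fun g => rfl
  have hexpc : Continuous fun g : SUN N => Real.exp (S g) := Real.continuous_exp.comp (continuous_restrict hS)
  have hexpi : Integrable (fun g : SUN N => Real.exp ((N : ℝ) * ((g : Matrix (Fin N) (Fin N) ℂ) * B).trace.re))
      (haarProbability (SUN N)) := integrable_of_continuous_SUN hexpc _
  haveI : IsProbabilityMeasure ν := isProbabilityMeasure_tilted hexpi
  set Z : ℝ := ∫ g : SUN N, Real.exp (S g) ∂(haarSU N) with hZ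
  have hZpos : 0 < Z := integral_exp_pos (integrable_of_continuous_SUN hexpc _)
  have htilt : ∀ f : SUN N → ℝ, ∫ g, f g ∂ν = (∫ g : SUN N, Real.exp (S g) * f g ∂(haarSU N)) / Z := fun f => by
    rw [hν]; exact integral_tilted_eq_div _ f
  -- the observables on `SU(N)`
  set w : SUN N → ℝ := fun s => (N : ℝ) * ((s : Matrix (Fin N) (Fin N) ℂ) * Δ).trace.re with hw
  set cr : SUN N → ℝ := fun g => c g with hcr
  set pM : SUN N → ℝ := fun g => pot 1 M (g : Matrix (Fin N) (Fin N) ℂ) with hpM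
  set Lg : SUN N → ℝ := fun g => genL S Ψ g with hLg
  have hcrc : Continuous cr := continuous_restrict hc
  have hpMc : Continuous pM := continuous_restrict (contDiff_pot 1 M)
  have hLgc : Continuous Lg := continuous_restrict (contDiff_genL hS hΨ)
  have hwc : Continuous w := continuous_const.mul (continuous_re_trace_su_mul Δ)
  have hφc : Continuous φ := continuous_of_lipschitz_suFrobDist hφL
  -- the pointwise identity `w = (N/λ)(κ + pot 1 M + N c − L_S Ψ)` on `SU(N)`
  have hweq : w = fun g => ((N : ℝ) / lam) * ((N : ℝ) * cr g + pM g - Lg g) + ((N : ℝ) / lam) * κ := by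
    funext g
    have h1 : w g = (N : ℝ) * pot 1 Δ g := by simp only [hw, pot, one_mul]
    have h2 := pot_eq_Gam_sub_genL hN S 1 Δ (g : Matrix (Fin N) (Fin N) ℂ)
    have h3 : Gam S (pot 1 Δ) g = (N : ℝ) * Gam (pot 1 B) (pot 1 Δ) g := by rw [hSdef, Gam_pot_left_smul]
    have h4 : (N : ℝ) * Gam (pot 1 B) (pot 1 Δ) g =
        κ + pM g + (N : ℝ) * cr g - Lap ψ g - (N : ℝ) * Gam (pot 1 B) ψ g := by
      have := hdec g; simp only [hpM, hcr]; linarith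
    have h5 : Lg g = genL S (pot 1 Δ) g + (Lap ψ g + (N : ℝ) * Gam (pot 1 B) ψ g) := by
      show genL S Ψ g = _
      rw [hΨdef, genL_add_apply S (contDiff_pot 1 Δ) hψ]
      show _ + (Lap ψ g + Gam S ψ g) = _
      rw [hSdef, Gam_pot_left_smul (N : ℝ) B ψ]
    have h6 : genL S (pot 1 Δ) (g : Matrix (Fin N) (Fin N) ℂ) = Lg g - Lap ψ g - (N : ℝ) * Gam (pot 1 B) ψ g := by
      rw [h5]; ring
    rw [h1, h2, h3, h4, h6]
    simp only [hlam]
    field_simp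
    ring
  -- `L²` memberships
  have mφ : MemLp φ 2 ν := by
    obtain ⟨C, hC⟩ := hφb
    exact MemLp.of_bound hφm.aestronglyMeasurable C (ae_of_all _ fun g => (Real.norm_eq_abs _).le.trans (hC g))
  have mcr : MemLp cr 2 ν := memLp_two_of_continuous hcrc ν
  have mpM : MemLp pM 2 ν := memLp_two_of_continuous hpMc ν
  have mLg : MemLp Lg 2 ν := memLp_two_of_continuous hLgc ν
  have mw : MemLp w 2 ν := memLp_two_of_continuous hwc ν
  -- the raw covariance is `cov[φ, w; ν]`
  have hcovw : ∫ s, φ s * w s ∂ν - (∫ s, φ s ∂ν) * ∫ s, w s ∂ν = cov[φ, w; ν] := by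
    rw [covariance_eq_sub mφ mw]; rfl
  -- split
  have hsplit : cov[φ, w; ν] = ((N : ℝ) / lam) * ((N : ℝ) * cov[φ, cr; ν] + cov[φ, pM; ν] - cov[φ, Lg; ν]) := by
    have hfc : Continuous fun g : SUN N => (N : ℝ) / lam * ((N : ℝ) * cr g + pM g - Lg g) :=
      continuous_const.mul (((continuous_const.mul hcrc).add hpMc).sub hLgc)
    have hfi : Integrable (fun g : SUN N => (N : ℝ) / lam * ((N : ℝ) * cr g + pM g - Lg g)) ν :=
      (memLp_two_of_continuous hfc ν).integrable one_le_two
    rw [hweq, covariance_add_const_right hfi]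
    have e : (fun g : SUN N => (N : ℝ) / lam * ((N : ℝ) * cr g + pM g - Lg g)) = ((N : ℝ) / lam) • ((((N : ℝ) • cr) + pM) - Lg) := by
      funext g; simp only [Pi.smul_apply, Pi.sub_apply, Pi.add_apply, smul_eq_mul]
    rw [e, covariance_smul_right, covariance_sub_right mφ ((mcr.const_smul _).add mpM) mLg,
      covariance_add_right mφ (mcr.const_smul _) mpM, covariance_smul_right]
  -- (1) the integration-by-parts term in `L²(ν)`: `|cov[φ, Lg]| ≤ L √(∫ Γ(Ψ,Ψ) dν)`
  have hLg0 : ∫ g, Lg g ∂ν = 0 := by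
    rw [htilt, integral_exp_mul_genL_eq_zero hN0 hS hΨ, zero_div]
  have hcovLg : cov[φ, Lg; ν] = ∫ g, φ g * Lg g ∂ν := by
    rw [covariance_eq_sub mφ mLg, hLg0, mul_zero, sub_zero]; rfl
  obtain ⟨CL, hCL⟩ := exists_abs_le_of_continuous hLgc
  have hCL0 : 0 ≤ CL := (abs_nonneg _).trans (hCL 1)
  have hwint : ∀ {f : SUN N → ℝ}, Continuous f → Integrable (fun g : SUN N => Real.exp (S g) * f g) (haarSU N) :=
    fun hf => integrable_of_continuous_SUN (hexpc.mul hf) _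
  set GΨ : ℝ := ∫ g, Gam Ψ Ψ g ∂ν with hGΨ
  have hGΨZ : ∫ g : SUN N, Real.exp (S g) * Gam Ψ Ψ g ∂(haarSU N) = GΨ * Z := by
    rw [hGΨ, htilt, div_mul_cancel₀ _ hZpos.ne']
  have hGΨ0 : 0 ≤ GΨ := by
    rw [hGΨ]; exact integral_nonneg fun g => Gam_self_nonneg Ψ g
  have hIBP : |cov[φ, Lg; ν]| ≤ L * Real.sqrt GΨ := by
    rw [hcovLg]
    refine le_of_forall_pos_le_add fun δ hδ => ?_
    set ε : ℝ := δ / (CL + 1) with hε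
    have hεpos : 0 < ε := div_pos hδ (by linarith)
    obtain ⟨F, hF, hΓF, hFφ⟩ := exists_smooth_approx hL hφL hεpos hN0
    have hFc : Continuous fun g : SUN N => F g := continuous_restrict hF
    have hFLg : ∫ g, F g * Lg g ∂ν = -(∫ g : SUN N, Real.exp (S g) * Gam F Ψ g ∂(haarSU N)) / Z := by
      rw [htilt]
      congr 1
      have : (fun g : SUN N => Real.exp (S g) * (F g * Lg g)) = fun g : SUN N => F g * (Real.exp (S g) * genL S Ψ g) := by
        funext g; simp only [hLg]; ring
      rw [this, integral_mul_exp_mul_genL hN0 hS hF hΨ]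
    have hFF : ∫ g : SUN N, Real.exp (S g) * Gam F F g ∂(haarSU N) ≤ L ^ 2 * Z := by
      calc ∫ g : SUN N, Real.exp (S g) * Gam F F g ∂(haarSU N)
          ≤ ∫ g : SUN N, Real.exp (S g) * L ^ 2 ∂(haarSU N) :=
            integral_mono (hwint (continuous_restrict (contDiff_Gam hF hF))) (hwint continuous_const)
              fun g => mul_le_mul_of_nonneg_left (hΓF g) (Real.exp_pos _).le
        _ = L ^ 2 * Z := by rw [integral_mul_const, hZ, mul_comm]
    have hA : |∫ g, F g * Lg g ∂ν| ≤ L * Real.sqrt GΨ := by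
      rw [hFLg, abs_div, abs_neg, abs_of_pos hZpos, div_le_iff₀ hZpos]
      calc |∫ g : SUN N, Real.exp (S g) * Gam F Ψ g ∂(haarSU N)|
          ≤ Real.sqrt (∫ g : SUN N, Real.exp (S g) * Gam F F g ∂(haarSU N)) *
              Real.sqrt (∫ g : SUN N, Real.exp (S g) * Gam Ψ Ψ g ∂(haarSU N)) := abs_integral_exp_mul_Gam_le hS hF hΨ _
        _ ≤ Real.sqrt (L ^ 2 * Z) * Real.sqrt (GΨ * Z) := by
            rw [hGΨZ]
            exact mul_le_mul_of_nonneg_right (Real.sqrt_le_sqrt hFF) (Real.sqrt_nonneg _)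
        _ = L * Real.sqrt GΨ * Z := by
            rw [Real.sqrt_mul (sq_nonneg _), Real.sqrt_sq hL, Real.sqrt_mul hGΨ0]
            have hz := Real.mul_self_sqrt hZpos.le
            linear_combination (L * Real.sqrt GΨ) * hz
    -- `∫ (φ - F) Lg dν` is small
    have i1 : Integrable (fun g : SUN N => φ g * Lg g) ν := mφ.integrable_mul mLg
    have i2 : Integrable (fun g : SUN N => F g * Lg g) ν := (memLp_two_of_continuous hFc ν).integrable_mul mLg
    have hB' : |∫ g, φ g * Lg g ∂ν - ∫ g, F g * Lg g ∂ν| ≤ ε * CL := by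
      rw [← integral_sub i1 i2]
      calc |∫ g, (φ g * Lg g - F g * Lg g) ∂ν| ≤ ∫ g, |φ g * Lg g - F g * Lg g| ∂ν := abs_integral_le_integral_abs
        _ ≤ ∫ g, ε * CL ∂ν := by
            refine integral_mono (i1.sub i2).abs (integrable_const _) fun g => ?_
            rw [← sub_mul, abs_mul]
            refine mul_le_mul ?_ (hCL g) (abs_nonneg _) hεpos.le
            rw [abs_sub_comm]; exact hFφ g
        _ = ε * CL := by simp
    have hεCL : ε * CL ≤ δ := by
      rw [hε, div_mul_eq_mul_div, div_le_iff₀ (by linarith)]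
      nlinarith
    calc |∫ g, φ g * Lg g ∂ν| = |(∫ g, φ g * Lg g ∂ν - ∫ g, F g * Lg g ∂ν) + ∫ g, F g * Lg g ∂ν| := by ring_nf
      _ ≤ |∫ g, φ g * Lg g ∂ν - ∫ g, F g * Lg g ∂ν| + |∫ g, F g * Lg g ∂ν| := abs_add_le _ _
      _ ≤ δ + L * Real.sqrt GΨ := add_le_add (hB'.trans hεCL) hA
      _ = L * Real.sqrt GΨ + δ := add_comm _ _
  -- (2) the remainder: `|cov[φ, c]| ≤ L √(∫ Γ(c,c) dν) / (N (1/2 − R))` (Poincaré twice: Lipschitz form for `φ`,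
  --     gradient form for `c`)
  have hK : 0 < (N : ℝ) * (1 / 2 - R) := mul_pos hNpos hRpos
  have hvarφ : Var[φ; ν] ≤ L ^ 2 / ((N : ℝ) * (1 / 2 - R)) := haarPoincare_SU hN B hB φ L hL hφL
  set Gc : ℝ := ∫ g, Gam c c g ∂ν with hGc
  have hGc0 : 0 ≤ Gc := by rw [hGc]; exact integral_nonneg fun g => Gam_self_nonneg c g
  have hvarc : Var[cr; ν] ≤ Gc / ((N : ℝ) * (1 / 2 - R)) := by
    have hK' : 0 < (N : ℝ) / 2 - |(N : ℝ)| * matrixOpNorm B := by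
      rw [abs_of_pos hNpos]; nlinarith
    have hP := poincare_pot hN0 (N : ℝ) B hK' hc
    set m : ℝ := (∫ g : SUN N, Real.exp (pot (N : ℝ) B g) * c g ∂(haarSU N)) /
      (∫ g : SUN N, Real.exp (pot (N : ℝ) B g) ∂(haarSU N)) with hm
    have hmean : ∫ g, cr g ∂ν = m := by rw [htilt]
    have hvar : Var[cr; ν] = (∫ g : SUN N, Real.exp (S g) * (c g - m) ^ 2 ∂(haarSU N)) / Z := by
      rw [ProbabilityTheory.variance_eq_integral hcrc.aemeasurable, hmean, htilt]
    have hKeq : (N : ℝ) / 2 - |(N : ℝ)| * matrixOpNorm B = (N : ℝ) * (1 / 2 - R) := by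
      rw [abs_of_pos hNpos, hRdef]; ring
    rw [hKeq] at hP
    rw [hvar, div_le_div_iff₀ hZpos hK, hGc, htilt, div_mul_eq_mul_div, le_div_iff₀ hZpos]
    calc (∫ g : SUN N, Real.exp (S g) * (c g - m) ^ 2 ∂(haarSU N)) * ((N : ℝ) * (1 / 2 - R)) * Z
        = ((N : ℝ) * (1 / 2 - R) * ∫ g : SUN N, Real.exp (pot (N : ℝ) B g) * (c g - m) ^ 2 ∂(haarSU N)) * Z := by
          rw [hSdef]; ring
      _ ≤ (∫ g : SUN N, Real.exp (pot (N : ℝ) B g) * Gam c c g ∂(haarSU N)) * Z :=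
          mul_le_mul_of_nonneg_right hP hZpos.le
      _ = (∫ g : SUN N, Real.exp (S g) * Gam c c g ∂(haarSU N)) * Z := by rw [hSdef]
  have hPoinc : |cov[φ, cr; ν]| ≤ L * Real.sqrt Gc / ((N : ℝ) * (1 / 2 - R)) := by
    have hcs : |cov[φ, cr; ν]| ≤ Real.sqrt (Var[φ; ν] * Var[cr; ν]) := by
      rw [← Real.sqrt_sq_eq_abs]; exact Real.sqrt_le_sqrt (cov_sq_le_var_mul_var mφ mcr)
    refine hcs.trans ?_
    have hprod : Var[φ; ν] * Var[cr; ν] ≤ (L * Real.sqrt Gc / ((N : ℝ) * (1 / 2 - R))) ^ 2 := by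
      calc Var[φ; ν] * Var[cr; ν] ≤ (L ^ 2 / ((N : ℝ) * (1 / 2 - R))) * (Gc / ((N : ℝ) * (1 / 2 - R))) :=
            mul_le_mul hvarφ hvarc (variance_nonneg _ _) (by positivity)
        _ = (L * Real.sqrt Gc / ((N : ℝ) * (1 / 2 - R))) ^ 2 := by
            rw [div_pow, mul_pow, Real.sq_sqrt hGc0]; field_simp
    calc Real.sqrt (Var[φ; ν] * Var[cr; ν]) ≤ Real.sqrt ((L * Real.sqrt Gc / ((N : ℝ) * (1 / 2 - R))) ^ 2) :=
          Real.sqrt_le_sqrt hprod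
      _ = L * Real.sqrt Gc / ((N : ℝ) * (1 / 2 - R)) := Real.sqrt_sq (by positivity)
  -- (3) assemble; the `pot 1 M` covariance is carried to the right-hand side as is
  have hcovM : ∫ s, φ s * pM s ∂ν - (∫ s, φ s ∂ν) * ∫ s, pM s ∂ν = cov[φ, pM; ν] := by
    rw [covariance_eq_sub mφ mpM]; rfl
  rw [hcovw, hsplit, abs_mul, abs_of_pos (div_pos hNpos hlampos), hlam_eq]
  rw [show (∫ s, φ s * pot 1 M (s : Matrix (Fin N) (Fin N) ℂ) ∂ν) - (∫ s, φ s ∂ν) * ∫ s, pot 1 M (s : Matrix (Fin N) (Fin N) ℂ) ∂ν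
      = cov[φ, pM; ν] from hcovM]
  have hfin : |(N : ℝ) * cov[φ, cr; ν] + cov[φ, pM; ν] - cov[φ, Lg; ν]| ≤
      (N : ℝ) * (L * Real.sqrt Gc / ((N : ℝ) * (1 / 2 - R))) + |cov[φ, pM; ν]| + L * Real.sqrt GΨ := by
    refine (abs_sub _ _).trans (add_le_add ((abs_add_le _ _).trans (add_le_add ?_ le_rfl)) hIBP)
    rw [abs_mul, abs_of_pos hNpos]
    exact mul_le_mul_of_nonneg_left hPoinc hNpos.le
  have hN21 : (0 : ℝ) < (N : ℝ) ^ 2 - 1 := by nlinarith only [hN2]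
  calc (N : ℝ) ^ 2 / ((N : ℝ) ^ 2 - 1) * |(N : ℝ) * cov[φ, cr; ν] + cov[φ, pM; ν] - cov[φ, Lg; ν]|
      ≤ (N : ℝ) ^ 2 / ((N : ℝ) ^ 2 - 1) *
          ((N : ℝ) * (L * Real.sqrt Gc / ((N : ℝ) * (1 / 2 - R))) + |cov[φ, pM; ν]| + L * Real.sqrt GΨ) :=
        mul_le_mul_of_nonneg_left hfin (by positivity)
    _ = (N : ℝ) ^ 2 / ((N : ℝ) ^ 2 - 1) * L * (Real.sqrt GΨ + Real.sqrt Gc / (1 / 2 - R))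
        + (N : ℝ) ^ 2 / ((N : ℝ) ^ 2 - 1) * |cov[φ, pM; ν]| := by
        field_simp
        ring

end Summit.Ventures.YMGap.OneLinkEigen
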